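import Mathlib
import HarnessLib
import Summits.Parity.BatemanHorn.Theorems.IsogenyRedeiSplitBlockJacobiRootWeylSumCRT

/-!
# Crux `SplitBlockJacobi` (stmt-Parity-11583, route `IsogenyRedei`), line `Ideate4Sketch`:
# stub `stub_dividingRow` — the degenerate CRT factor of the root Weyl sum

For distinct primes `Q, Q'` with `Q ≡ 1 (mod 4)` and `Q ∣ h`, the root Weyl sum
`S(h, q) = Σ_{ν mod q, ν² ≡ -1 (q)} e(hν/q)` (the skeleton's `rootWeylSum h q`, body expanded)
satisfies `S(h, QQ') = 2 · S(h/Q, Q')`.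

Proof: twisted multiplicativity `S(h, QQ') = S(h Q̄', Q) · S(h Q̄, Q')` (tree,
`rootWeylSum_mul_of_coprime`); with `h = Q h'` every phase of the first factor is `e(integer) = 1`,
so it equals `ρ(Q) = 2` (`Weyl.card_roots_eq_two_of_prime_mod_four_eq_one`), and in the second
factor `Q h' Q̄ ≡ h' (mod Q')`, so termwise `e(Q h' Q̄ ν / Q') = e(h' ν / Q')`.
-/

noncomputable section

open Finset

namespace Summit.Parity.BatemanHorn.Cruxes.SplitBlockJacobi.SalieTwistAbsorption

open Summit.Parity.BatemanHorn.Cruxes.SplitBlockJacobi.CofactorRootDiscrepancy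

/-- **Stub B — the degenerate CRT factor** (line `Ideate4Sketch` of stmt-Parity-11583): for distinct
primes `Q, Q'` with `Q ≡ 1 (mod 4)` and `Q ∣ h`, `S(h, QQ') = 2·S(h/Q, Q')`: the phase
`e(hν/(QQ')) = e((h/Q)ν/Q')` only sees `ν mod Q'`, and each root mod `Q'` has `ρ(Q) = 2` lifts.
[folklore] -/
theorem stub_dividingRow :
    ∀ (h : ℤ) (Q Q' : ℕ), Q.Prime → Q'.Prime → Q % 4 = 1 → Q ≠ Q' → (Q : ℤ) ∣ h →
      ∑ ν ∈ (Finset.range (Q * Q')).filter (fun ν : ℕ => Q * Q' ∣ ν ^ 2 + 1), Complex.exp (2 * Real.pi * Complex.I * (h : ℂ) * (ν : ℂ) / ((Q * Q' : ℕ) : ℂ)) = 2 * (∑ ν ∈ (Finset.range Q').filter (fun ν : ℕ => Q' ∣ ν ^ 2 + 1), Complex.exp (2 * Real.pi * Complex.I * ((h / Q : ℤ) : ℂ) * (ν : ℂ) / (Q' : ℂ))) := by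
  intro h Q Q' hQ hQ' hQ4 hne hdvd
  have hco : Nat.Coprime Q Q' := (Nat.coprime_primes hQ hQ').mpr hne
  -- inverses `Q' u₂ ≡ 1 (mod Q)`, `Q u₁ ≡ 1 (mod Q')`
  obtain ⟨u₂, -, hu₂⟩ := Nat.exists_mul_mod_eq_of_coprime 1 hco.symm hQ.ne_zero
  obtain ⟨u₁, -, hu₁⟩ := Nat.exists_mul_mod_eq_of_coprime 1 hco hQ'.ne_zero
  rw [rootWeylSum_mul_of_coprime h hco (u₁ := u₁) (u₂ := u₂) hu₂ hu₁]
  obtain ⟨h', rfl⟩ := hdvd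
  have hQz : (Q : ℤ) ≠ 0 := by exact_mod_cast hQ.ne_zero
  have hQc : (Q : ℂ) ≠ 0 := by exact_mod_cast hQ.ne_zero
  have hQ'c : (Q' : ℂ) ≠ 0 := by exact_mod_cast hQ'.ne_zero
  rw [Int.mul_ediv_cancel_left _ hQz]
  congr 1
  · -- the `Q`-factor: every phase is `e(h' u₂ ν) = 1`, and there are `ρ(Q) = 2` roots
    rw [Finset.sum_congr rfl (g := fun _ => (1 : ℂ)) ?_]
    · rw [Finset.sum_const, Weyl.card_roots_eq_two_of_prime_mod_four_eq_one hQ hQ4]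
      norm_num
    · intro ν _
      refine Complex.exp_eq_one_iff.mpr ⟨h' * u₂ * ν, ?_⟩
      have e3 : (Q : ℂ) * ((h' : ℂ) * (u₂ : ℂ) * (ν : ℂ)) / (Q : ℂ) = (h' : ℂ) * (u₂ : ℂ) * (ν : ℂ) :=
        mul_div_cancel_left₀ _ hQc
      push_cast
      linear_combination (2 * Real.pi * Complex.I) * e3
  · -- the `Q'`-factor: `Q h' u₁ ≡ h' (mod Q')`
    refine Finset.sum_congr rfl fun ν _ => ?_
    obtain ⟨k, hk⟩ := Nat.modEq_iff_dvd.mp hu₁.symm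
    refine Complex.exp_eq_exp_iff_exists_int.mpr ⟨h' * ν * k, ?_⟩
    have hkC : ((Q * u₁ : ℕ) : ℂ) - ((1 : ℕ) : ℂ) = (Q' : ℂ) * (k : ℂ) := by exact_mod_cast hk
    have e1 : (Q : ℂ) * (u₁ : ℂ) = 1 + (Q' : ℂ) * (k : ℂ) := by
      push_cast at hkC
      linear_combination hkC
    have e2 : (Q' : ℂ) * (k : ℂ) / (Q' : ℂ) = (k : ℂ) := mul_div_cancel_left₀ _ hQ'c
    push_cast
    linear_combination (2 * Real.pi * Complex.I * (h' : ℂ) * (ν : ℂ) / (Q' : ℂ)) * e1 +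
      (2 * Real.pi * Complex.I * (h' : ℂ) * (ν : ℂ)) * e2

end Summit.Parity.BatemanHorn.Cruxes.SplitBlockJacobi.SalieTwistAbsorption
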